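import Mathlib

/-!
# SoloBlindLiftTorsor — the 16 `Q₈`-lifts of an isotropic plane form one orbit (LEMMA L16 certificate)

Solo programme `solo-HodgeConjecture-blind`, session s53 (THEOREM Ψ₀, `work/s53/ks-partner.md`).

Setting. `π₁(Σ₃) = ⟨a₁,b₁,a₂,b₂,a₃,b₃ ∣ R⟩`, `R = [a₁,b₁][a₂,b₂][a₃,b₃]`.  The normal-form
epimorphism onto `Q₈ = QuaternionGroup 2` is `ρ₀ = (1,1,1,i,1,j)`; its kernel datum mod 2 is the
isotropic plane `V = ⟨b₂*, b₃*⟩` (the functionals reading the `b₂`-, `b₃`-exponent sums).  The lifts of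
`V` up to `Inn Q₈` are the 16 epimorphisms `ρ_s = (s₁,s₂,s₃,i,s₅,j)`, `sₖ ∈ {±1}` (a torsor under
`H¹(Σ₃,𝔽₂)/V`).  We certify, by `decide` only:

* `*_rel`, `*_inv` : the five substitutions `A1 : b₁ ↦ b₁a₁`, `B1 : a₁ ↦ a₁b₁`, `B2sq : a₂ ↦ a₂b₂²`,
  `B3sq : a₃ ↦ a₃b₃²`, `C12 : b₁ ↦ a₁⁻¹b₃a₃b₃⁻¹a₃⁻¹a₂⁻¹b₁, b₂ ↦ a₂⁻¹b₁a₁⁻¹b₁⁻¹a₂b₂a₂⁻¹` (free reductions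
  of Dehn twists computed in s27) map `R` to a conjugate of `R` **in the free group** `FreeGroup (Fin 6)`
  and are invertible there — so they are orientation-preserving mapping classes (Dehn–Nielsen–Baer);
* `twists_fix_V`, `B2ctl_moves_V` : they fix the functionals `b₂*, b₃*` (so lie in `Mod₃[V]`), while
  the control twist `B2ctl : a₂ ↦ a₂b₂` does not;
* `lifts_relator`, `lifts_onto` : each `ρ_s` kills `R` and is onto `Q₈`;
* `class_conj`, `variants_conj` : the class map is `Inn`-invariant and the four `(i^{±1}, j^{±1})`
  variants of a normal form are `Inn`-conjugate;
* `twists_act` : each twist sends each `ρ_s` to a tuple of normal shape (so to another lift of `V`);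
* `one_orbit` : the closure of `ρ₊ = (1,1,1,i,1,j)` under the five twists is all 16 classes;
  `control_orbit` : under `{A1,B1,C12}` alone `ρ₊` is fixed (so the `Bₖ²` are needed).

Consequence used in THEOREM Ψ₀: `Mod₃[V]` acts transitively on the 16 lifts of `V`; together with the
index count `5040/315 = 16` (`index_count`) every `Mod₃[V]`-orbit on `Q₈`-structures has ≥ 16 elements.
-/

namespace Summit.HodgeConjecture.HodgeConjecture.Theorems.LiftTorsor

set_option maxHeartbeats 4000000
set_option maxRecDepth 4000

/-- Words in six generators `0=a₁, 1=b₁, 2=a₂, 3=b₂, 4=a₃, 5=b₃`; `(k,true)` is the generator,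
`(k,false)` its inverse (the `FreeGroup.mk` convention). -/
abbrev W := List (Fin 6 × Bool)

/-- Formal inverse of a word. -/
def winv (l : W) : W := (l.map fun p => (p.1, !p.2)).reverse

/-- A substitution: generator ↦ word. -/
abbrev Subst := Fin 6 → W

/-- Apply a substitution to a word. -/
def subst (φ : Subst) (l : W) : W := l.flatMap fun p => if p.2 then φ p.1 else winv (φ p.1)

/-- The surface relator `R = [a₁,b₁][a₂,b₂][a₃,b₃]`. -/
def R : W := [(0,true),(1,true),(0,false),(1,false),(2,true),(3,true),(2,false),(3,false),
  (4,true),(5,true),(4,false),(5,false)]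

/-- Identity substitution. -/
def idS : Subst := fun k => [(k,true)]
/-- Dehn twist `t_{a₁}` on `π₁`: `b₁ ↦ b₁a₁`. -/
def A1 : Subst := fun k => if k = 1 then [(1,true),(0,true)] else [(k,true)]
/-- Dehn twist `t_{b₁}`: `a₁ ↦ a₁b₁`. -/
def B1 : Subst := fun k => if k = 0 then [(0,true),(1,true)] else [(k,true)]
/-- Square of the Dehn twist `t_{b₂}`: `a₂ ↦ a₂b₂²`. -/
def B2sq : Subst := fun k => if k = 2 then [(2,true),(3,true),(3,true)] else [(k,true)]
/-- Square of the Dehn twist `t_{b₃}`: `a₃ ↦ a₃b₃²`. -/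
def B3sq : Subst := fun k => if k = 4 then [(4,true),(5,true),(5,true)] else [(k,true)]
/-- Control: the single twist `t_{b₂}`: `a₂ ↦ a₂b₂` (a mapping class NOT in `Mod₃[V]`). -/
def B2ctl : Subst := fun k => if k = 2 then [(2,true),(3,true)] else [(k,true)]
/-- The chain twist `C₁₂` (free reduction of the s27 Dehn-twist image along a curve of class `a₁+a₂`):
`b₁ ↦ a₁⁻¹b₃a₃b₃⁻¹a₃⁻¹a₂⁻¹b₁`, `b₂ ↦ a₂⁻¹b₁a₁⁻¹b₁⁻¹a₂b₂a₂⁻¹`. -/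
def C12 : Subst := fun k =>
  if k = 1 then [(0,false),(5,true),(4,true),(5,false),(4,false),(2,false),(1,true)]
  else if k = 3 then [(2,false),(1,true),(0,false),(1,false),(2,true),(3,true),(2,false)]
  else [(k,true)]
/-- Conjugator for `C₁₂`: `C₁₂(R) = w R w⁻¹` in the free group. -/
def wC12 : W := [(5,true),(4,true),(5,false),(4,false),(2,false),(1,true),(0,false),(1,false),(2,true),
  (3,true),(2,true),(3,false),(2,false),(1,true),(0,true),(1,false),(0,false)]
/-- Inverse of `A1`: `b₁ ↦ b₁a₁⁻¹`. -/
def A1inv : Subst := fun k => if k = 1 then [(1,true),(0,false)] else [(k,true)]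
/-- Inverse of `B1`: `a₁ ↦ a₁b₁⁻¹`. -/
def B1inv : Subst := fun k => if k = 0 then [(0,true),(1,false)] else [(k,true)]
/-- Inverse of `B2sq`: `a₂ ↦ a₂b₂⁻²`. -/
def B2sqinv : Subst := fun k => if k = 2 then [(2,true),(3,false),(3,false)] else [(k,true)]
/-- Inverse of `B3sq`: `a₃ ↦ a₃b₃⁻²`. -/
def B3sqinv : Subst := fun k => if k = 4 then [(4,true),(5,false),(5,false)] else [(k,true)]
/-- Inverse of `C₁₂`: `b₁ ↦ a₂a₃b₃a₃⁻¹b₃⁻¹a₁b₁`, `b₂ ↦ a₃b₃a₃⁻¹b₃⁻¹a₁b₁a₁b₁⁻¹a₁⁻¹b₃a₃b₃⁻¹a₃⁻¹b₂a₂`. -/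
def C12inv : Subst := fun k =>
  if k = 1 then [(2,true),(4,true),(5,true),(4,false),(5,false),(0,true),(1,true)]
  else if k = 3 then [(4,true),(5,true),(4,false),(5,false),(0,true),(1,true),(0,true),(1,false),(0,false),
    (5,true),(4,true),(5,false),(4,false),(3,true),(2,true)]
  else [(k,true)]

/-- The class of a word in the free group `F₆`. -/
abbrev fg (l : W) : FreeGroup (Fin 6) := FreeGroup.mk l

/-! ## Mapping-class certificates in the free group -/

/-- `A1(R) = R` in `F₆`. -/
theorem A1_rel : fg (subst A1 R) = fg R := by decide
/-- `B1(R) = R` in `F₆`. -/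
theorem B1_rel : fg (subst B1 R) = fg R := by decide
/-- `B2sq(R) = R` in `F₆`. -/
theorem B2sq_rel : fg (subst B2sq R) = fg R := by decide
/-- `B3sq(R) = R` in `F₆`. -/
theorem B3sq_rel : fg (subst B3sq R) = fg R := by decide
/-- `B2ctl(R) = R` in `F₆` (the control is a mapping class too). -/
theorem B2ctl_rel : fg (subst B2ctl R) = fg R := by decide
/-- `C12(R) = w R w⁻¹` in `F₆`. -/
theorem C12_rel : fg (subst C12 R) = fg wC12 * fg R * (fg wC12)⁻¹ := by decide

/-- `A1` is an automorphism of `F₆`: two-sided inverse `A1inv` on generators. -/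
theorem A1_inv : ∀ k : Fin 6, fg (subst A1 (A1inv k)) = FreeGroup.of k ∧ fg (subst A1inv (A1 k)) = FreeGroup.of k := by
  decide
/-- `B1` is an automorphism of `F₆` (two-sided inverse `B1inv`). -/
theorem B1_inv : ∀ k : Fin 6, fg (subst B1 (B1inv k)) = FreeGroup.of k ∧ fg (subst B1inv (B1 k)) = FreeGroup.of k := by
  decide
/-- `B2sq` is an automorphism of `F₆` (two-sided inverse `B2sqinv`). -/
theorem B2sq_inv : ∀ k : Fin 6, fg (subst B2sq (B2sqinv k)) = FreeGroup.of k ∧ fg (subst B2sqinv (B2sq k)) = FreeGroup.of k := by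
  decide
/-- `B3sq` is an automorphism of `F₆` (two-sided inverse `B3sqinv`). -/
theorem B3sq_inv : ∀ k : Fin 6, fg (subst B3sq (B3sqinv k)) = FreeGroup.of k ∧ fg (subst B3sqinv (B3sq k)) = FreeGroup.of k := by
  decide
/-- `C12` is an automorphism of `F₆` (two-sided inverse `C12inv`). -/
theorem C12_inv : ∀ k : Fin 6, fg (subst C12 (C12inv k)) = FreeGroup.of k ∧ fg (subst C12inv (C12 k)) = FreeGroup.of k := by
  decide

/-! ## Evaluation, `V`-preservation -/

/-- Evaluate a word under an assignment of the generators in a group. -/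
def evalW {G : Type*} [Group G] (ρ : Fin 6 → G) (l : W) : G :=
  (l.map fun p => if p.2 then ρ p.1 else (ρ p.1)⁻¹).prod

/-- The five twists used for the orbit. -/
def twists : List Subst := [A1, B1, C12, B2sq, B3sq]

/-- Mod-2 test assignment reading the functionals `b₂*` (first coordinate) and `b₃*` (second). -/
def vV : Fin 6 → Multiplicative (ZMod 2 × ZMod 2) := fun k =>
  if k = 3 then Multiplicative.ofAdd (1,0) else if k = 5 then Multiplicative.ofAdd (0,1) else 1

/-- The five twists fix `b₂*` and `b₃*` on every generator, i.e. preserve `V` (lie in `Mod₃[V]` mod 2). -/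
theorem twists_fix_V : ∀ φ ∈ twists, ∀ k : Fin 6, evalW vV (φ k) = vV k := by decide
/-- Control: the single twist `t_{b₂}` moves `V` (`a₂ ↦ a₂b₂` changes the `b₂`-parity of `a₂`). -/
theorem B2ctl_moves_V : evalW vV (B2ctl 2) ≠ vV 2 := by decide

/-! ## The 16 lifts in `Q₈` and the orbit -/

/-- `Q₈`. -/
abbrev Q := QuaternionGroup 2
/-- `i = a 1`. -/
def qi : Q := QuaternionGroup.a 1
/-- `j = xa 0`. -/
def qj : Q := QuaternionGroup.xa 0
/-- `-1 = a 2`. -/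
def neg1 : Q := QuaternionGroup.a 2

/-- Sign vectors `(s₁,s₂,s₃,s₅)` (`true` = `-1`) labelling the 16 lifts. -/
abbrev S := Bool × Bool × Bool × Bool
/-- Sign as an element of `Q₈`. -/
def sg (b : Bool) : Q := if b then neg1 else 1
/-- The lift `ρ_s = (s₁, s₂, s₃, i, s₅, j)`. -/
def lift (s : S) : Fin 6 → Q := fun k =>
  if k = 0 then sg s.1 else if k = 1 then sg s.2.1 else if k = 2 then sg s.2.2.1
  else if k = 3 then qi else if k = 4 then sg s.2.2.2 else qj
/-- The four variants `(s₁,s₂,s₃,i^{±1},s₅,j^{±1})` of a normal form. -/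
def variant (s : S) (e3 e5 : Bool) : Fin 6 → Q := fun k =>
  if k = 3 then (if e3 then qi⁻¹ else qi) else if k = 5 then (if e5 then qj⁻¹ else qj) else lift s k
/-- Precomposition of an assignment with a substitution: `k ↦ ρ(φ k)`. -/
def act (φ : Subst) (ρ : Fin 6 → Q) : Fin 6 → Q := fun k => evalW ρ (φ k)
/-- Is `g` central (`±1`)? -/
def isSign (g : Q) : Bool := decide (g = 1 ∨ g = neg1)
/-- Class read-off: a tuple of normal shape `(±1,±1,±1,i^{±1},±1,j^{±1})` has `Inn Q₈`-class labelled by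
its four central entries (conjugation by `i, j, k` realises all sign patterns on the `i`- and `j`-slots,
`variants_conj`, and fixes central entries); `none` if the tuple is not of normal shape. -/
def classOf (ρ : Fin 6 → Q) : Option S :=
  if isSign (ρ 0) ∧ isSign (ρ 1) ∧ isSign (ρ 2) ∧ isSign (ρ 4) ∧ (ρ 3 = qi ∨ ρ 3 = qi⁻¹) ∧
      (ρ 5 = qj ∨ ρ 5 = qj⁻¹) then
    some (decide (ρ 0 = neg1), decide (ρ 1 = neg1), decide (ρ 2 = neg1), decide (ρ 4 = neg1))
  else none

/-- Every lift kills the relator. -/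
theorem lifts_relator : ∀ s : S, evalW (lift s) R = 1 := by decide
/-- Every lift is onto `Q₈` (its `i`- and `j`-entries generate). -/
theorem lifts_onto : ∀ s : S, ∀ g : Q, ∃ m : Fin 4, ∃ e : Bool,
    g = (lift s 3) ^ (m : ℕ) * (if e then lift s 5 else 1) := by decide
/-- The class map recovers the label and is invariant under `Inn Q₈` on normal forms. -/
theorem class_conj : ∀ s : S, ∀ g : Q, classOf (fun k => g * lift s k * g⁻¹) = some s := by decide
/-- The four `(i^{±1}, j^{±1})` variants of a normal form are `Inn`-conjugate to it. -/
theorem variants_conj : ∀ s : S, ∀ e3 e5 : Bool, ∃ g : Q, (fun k => g * variant s e3 e5 k * g⁻¹) = lift s := by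
  decide
/-- Each of the five twists maps each lift to a tuple of normal shape (hence to a lift of `V`). -/
theorem twists_act : ∀ φ ∈ twists, ∀ s : S, (classOf (act φ (lift s))).isSome = true := by decide

/-- Images of a label under the five twists. -/
def imgs (s : S) : List S := twists.filterMap fun φ => classOf (act φ (lift s))
/-- Images under `{A1, B1, C12}` only (control). -/
def imgs3 (s : S) : List S := [A1, B1, C12].filterMap fun φ => classOf (act φ (lift s))
/-- Breadth-first closure, `n` rounds. -/
def closure (f : S → List S) : ℕ → List S → List S
  | 0, l => l
  | n+1, l => closure f n (l ++ l.flatMap f).dedup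

/-- The base lift `ρ₊ = (1,1,1,i,1,j)`. -/
def base : S := (false, false, false, false)

/-- ONE ORBIT: every one of the 16 labels is reached from `ρ₊` by words of length ≤ 6 in the five twists. -/
theorem one_orbit : ∀ s : S, s ∈ closure imgs 6 [base] := by decide
/-- Control: under `{A1, B1, C12}` alone `ρ₊` is fixed (the squares `B2sq`, `B3sq` are needed). -/
theorem control_orbit : closure imgs3 6 [base] = [base] := by decide
/-- The index count behind the orbit floor: isotropic planes in `𝔽₂⁶` = ordered hyperbolic-free pairs
`63 · 30` over `|GL₂(𝔽₂)| = 6` `= 315`, and `5040 / 315 = 16`. -/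
theorem index_count : 63 * 30 / 6 = 315 ∧ 63 * 30 % 6 = 0 ∧ 5040 / 315 = 16 ∧ 5040 % 315 = 0 := by decide

end Summit.HodgeConjecture.HodgeConjecture.Theorems.LiftTorsor
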